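import Summits.KontsevichZagierPeriods.KontsevichZagierPeriods.Theorems.SoloBlindTriplThirdPrep
import HarnessLib

/-!
# Solo/blind — Triplication IV: the shadow `3a+b=3` is one-dimensional too

With the pull-back `3^{b-1}P₂` (`tri_pullback2`) and the primitive `ρ₂`
(`hasDerivAt_triRho2`, `ρ₂(0)=ρ₂(1)=0`) of `SoloBlindTriplThirdPrep`, the KZ chain
substitution → rule (3) → two additivity splits gives, with no division,

  `(2-2a)·β(a,b) = 3^{b-1}·[ ((3a-2)/3)·β(2a-1, (b+1)/3) + ((3a-1)/3)·β(2a-1, (b+2)/3) ]`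

for rational `a > 1/2`, `b > 0`, `3a+b=3`.  At level `9`: `a = 7/9` gives `{5,6,7} ~ {5,5,8}` and
`a = 8/9` gives `{3,7,8} ~ {4,7,7}`; together with `SoloBlindTriplication` (first kind) and
`SoloBlindTriplSecond` (`{4,6,8} ~ {8,8,2}`) all six Deligne–Koblitz–Ogus merges at `N = 9` are
derived inside the rules by one-dimensional chains.
-/

namespace Summit.KontsevichZagierPeriods.KontsevichZagierPeriods.Theorems

open Literature.NumberTheory.Transcendental Literature.NumberTheory.Transcendental.KZ
open Literature.NumberTheory.Transcendental.KZ.IntegralRep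
open Literature.ModelTheory.ExponentialFields
open MeasureTheory Set Real Polynomial

noncomputable section

namespace SoloBlind

variable {a b : ℚ}

/-! ## The representations and the moves -/

/-- `[(0,1), P₂]`. -/
def triPRep2 (a b : ℚ) (ha : 1 / 2 < a) (hb : 0 < b) (h : 3 * a + b = 3) : IntegralRep 1 :=
  lineRep (Ioo 0 1) (triP2 a b) mix_line_sa (sa_triP2 a b)
    (integrableOn_triP2 a b (by linarith) hb h)

/-- `[(0,1), W₂]`. -/
def triWRep2 (a b : ℚ) (ha : 1 / 2 < a) (hb : 0 < b) : IntegralRep 1 :=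
  lineRep (Ioo 0 1) (triW2 a b) mix_line_sa (sa_triW2 a b) (integrableOn_triW2 a b ha hb)

/-- The source `[(0,1), 3^{b-1} P₂]`. -/
def triSrc2 (a b : ℚ) (ha : 1 / 2 < a) (hb : 0 < b) (h : 3 * a + b = 3) : IntegralRep 1 :=
  lineRep (Ioo 0 1) (triF2 a b) mix_line_sa
    ((isSemialgebraicFunOn_const_of_isAlgebraic mix_line_sa (tri_coeff_isAlgebraic b)).mul_holds
      (sa_triP2 a b))
    (integrableOn_triF2 a b (by linarith) hb h)

/-- The source is `3^{b-1}` times `[(0,1), P₂]`, literally. -/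
theorem triSrc2_eq (a b : ℚ) (ha : 1 / 2 < a) (hb : 0 < b) (h : 3 * a + b = 3) :
    triSrc2 a b ha hb h = (triPRep2 a b ha hb h).constMul ((3:ℝ) ^ ((b : ℝ) - 1))
      (tri_coeff_isAlgebraic b) :=
  IntegralRep.ext' rfl rfl

/-- **Move 1, the substitution `t = Ψ(u)`: `[(0,1), 3^{b-1}P₂] ≡ β(a,b)`.** -/
theorem triSrc2_sub_betaRep (a b : ℚ) (ha : 1 / 2 < a) (hb : 0 < b) (h : 3 * a + b = 3) :
    of (triSrc2 a b ha hb h) - of (betaRep a b (one_half_pos.trans ha) hb) ∈ relations := by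
  unfold triSrc2 betaRep
  exact lineRep_subst triPsi triPsi' isSemialgebraicFunOn_triPsi
    (fun t ht => (hasDerivAt_triPsi ht.2).hasDerivWithinAt) injOn_triPsi image_triPsi
    (fun t ht => tri_pullback2 a b h ht)

/-- `X = [[0,1], ρ₂']`. -/
def triExact2 (a b : ℚ) (ha : 1 / 2 < a) (hb : 0 < b) (h : 3 * a + b = 3) : IntegralRep 1 :=
  lineRep (Icc 0 1) (triE2 a b) (isSemialgebraic_line_Icc isAlgebraic_zero isAlgebraic_one)
    (sa_triE2 a b) (integrableOn_triE2 a b ha hb h)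

/-- **Move 2, rule (3)**: `[[0,1], ρ₂'] ∈ relations`, since `ρ₂(1) - ρ₂(0) = 0`. -/
theorem triExact2_mem (a b : ℚ) (ha : 1 / 2 < a) (hb : 0 < b) (h : 3 * a + b = 3) :
    of (triExact2 a b ha hb h) ∈ relations := by
  have h0 : triRho2 a b 1 - triRho2 a b 0 = 0 := by rw [triRho2_one hb, triRho2_zero ha, sub_zero]
  have h1 : of (triExact2 a b ha hb h) -
      of (constCell (triRho2 a b 1 - triRho2 a b 0) (by rw [h0]; exact isAlgebraic_zero)) ∈
      relations :=
    lineRep_newtonLeibniz isAlgebraic_zero isAlgebraic_one zero_le_one (triRho2 a b)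
      (sa_triRho2 ha hb) (continuous_triRho2 ha hb).continuousOn
      fun t ht => by rw [triE2, if_pos ht]; exact hasDerivAt_triRho2 h ht
  have hc : of (constCell (triRho2 a b 1 - triRho2 a b 0) (by rw [h0]; exact isAlgebraic_zero)) ∈
      relations := by
    rw [constCell_congr h0 (hβ := isAlgebraic_zero)]
    exact constCell_zero
  simpa using relations.add_mem h1 hc

/-- `X⁰ = [(0,1), ρ₂']`, the open restriction. -/
def triExact2O (a b : ℚ) (ha : 1 / 2 < a) (hb : 0 < b) (h : 3 * a + b = 3) : IntegralRep 1 :=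
  (triExact2 a b ha hb h).restrict (line (Ioo 0 1)) mix_line_sa fun _ hx => Ioo_subset_Icc_self hx

/-- `[(0,1), ρ₂'] ∈ relations`. -/
theorem triExact2O_mem (a b : ℚ) (ha : 1 / 2 < a) (hb : 0 < b) (h : 3 * a + b = 3) :
    of (triExact2O a b ha hb h) ∈ relations := by
  have h1 : of (triExact2 a b ha hb h) - of (triExact2O a b ha hb h) ∈ relations := by
    refine IntegralRep.of_sub_of_restrict_mem_relations _ _ _ ?_
    show volume (line (Icc (0 : ℝ) 1) \ line (Ioo 0 1)) = 0
    rw [← show line (Icc (0 : ℝ) 1 \ Ioo 0 1) = line (Icc (0 : ℝ) 1) \ line (Ioo 0 1) from rfl,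
      volume_line, Icc_sdiff_Ioo_same zero_le_one]
    exact (toFinite _).measure_zero _
  have h2 := relations.sub_mem (triExact2_mem a b ha hb h) h1
  rwa [sub_sub_cancel] at h2

/-- **Move 3, rule (1b)**: `[(0,1), ρ₂'] ≡ (2a-2)•[(0,1),P₂] + [(0,1),W₂]`. -/
theorem triExact2O_sub_sub (a b : ℚ) (ha : 1 / 2 < a) (hb : 0 < b) (h : 3 * a + b = 3) :
    of (triExact2O a b ha hb h) -
      of ((triPRep2 a b ha hb h).constMul (((2 * a - 2 : ℚ)) : ℝ) (isAlgebraic_rat ℚ (2 * a - 2))) -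
      of (triWRep2 a b ha hb) ∈ relations := by
  refine of_sub_sub_mem_relations_of_add rfl rfl fun x hx => ?_
  have hx' : x 0 ∈ Ioo (0 : ℝ) 1 := hx
  simp only [triExact2O, IntegralRep.integrand_restrict, triExact2, lineRep_integrand,
    IntegralRep.integrand_constMul, triPRep2, triWRep2]
  rw [triE2, if_pos hx']

/-- **Move 4, rule (1b)**: `[(0,1), W₂] ≡ ((3a-2)/3)•β(2a-1,(b+1)/3) + ((3a-1)/3)•β(2a-1,(b+2)/3)`. -/
theorem triWRep2_sub_sub (a b : ℚ) (ha : 1 / 2 < a) (hb : 0 < b) (ha2 : 0 < 2 * a - 1)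
    (hb13 : 0 < (b + 1) / 3) (hb23 : 0 < (b + 2) / 3) :
    of (triWRep2 a b ha hb) -
      of ((betaRep (2 * a - 1) ((b + 1) / 3) ha2 hb13).constMul ((((3 * a - 2) / 3 : ℚ)) : ℝ)
        (isAlgebraic_rat ℚ ((3 * a - 2) / 3))) -
      of ((betaRep (2 * a - 1) ((b + 2) / 3) ha2 hb23).constMul ((((3 * a - 1) / 3 : ℚ)) : ℝ)
        (isAlgebraic_rat ℚ ((3 * a - 1) / 3))) ∈ relations :=
  of_sub_sub_mem_relations_of_add rfl rfl fun _ _ => rfl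

/-! ## Assembly in `Q` -/

/-- `β(a,b) = 3^{b-1} • [(0,1), P₂]` in `Q`. -/
theorem betaQ_eq_triCoeff_smul_P2 (a b : ℚ) (ha : 1 / 2 < a) (hb : 0 < b) (h : 3 * a + b = 3) :
    betaQ a b = triCoeff b • mkQ (of (triPRep2 a b ha hb h)) := by
  rw [betaQ_eq (one_half_pos.trans ha) hb,
    ← mkQ_eq_mkQ_iff.mpr (triSrc2_sub_betaRep a b ha hb h), triSrc2_eq, mkQ_constMul]
  rfl

/-- `(2a-2)•[(0,1),P₂] + [(0,1),W₂] = 0` in `Q`. -/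
theorem triP2_add_triW2_eq_zero (a b : ℚ) (ha : 1 / 2 < a) (hb : 0 < b) (h : 3 * a + b = 3) :
    ((2 * a - 2 : ℚ) : K₀) • mkQ (of (triPRep2 a b ha hb h)) + mkQ (of (triWRep2 a b ha hb)) = 0 := by
  have h1 := relations.sub_mem (triExact2O_sub_sub a b ha hb h) (triExact2O_mem a b ha hb h)
  have e : of (triExact2O a b ha hb h) -
      of ((triPRep2 a b ha hb h).constMul (((2 * a - 2 : ℚ)) : ℝ) (isAlgebraic_rat ℚ (2 * a - 2))) -
      of (triWRep2 a b ha hb) - of (triExact2O a b ha hb h) =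
      -(of ((triPRep2 a b ha hb h).constMul (((2 * a - 2 : ℚ)) : ℝ)
          (isAlgebraic_rat ℚ (2 * a - 2))) + of (triWRep2 a b ha hb)) := by abel
  rw [e] at h1
  have h1' := relations.neg_mem h1
  rw [neg_neg] at h1'
  have h2 := mkQ_eq_zero_iff.mpr h1'
  rwa [map_add, mkQ_constMul_ratCast] at h2

/-- `[(0,1),W₂] = ((3a-2)/3)•β(2a-1,(b+1)/3) + ((3a-1)/3)•β(2a-1,(b+2)/3)` in `Q`. -/
theorem mkQ_triWRep2 (a b : ℚ) (ha : 1 / 2 < a) (hb : 0 < b) :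
    mkQ (of (triWRep2 a b ha hb)) = (((3 * a - 2) / 3 : ℚ) : K₀) • betaQ (2 * a - 1) ((b + 1) / 3) +
      (((3 * a - 1) / 3 : ℚ) : K₀) • betaQ (2 * a - 1) ((b + 2) / 3) := by
  have ha2 : (0:ℚ) < 2 * a - 1 := by linarith
  have hb13 : (0:ℚ) < (b + 1) / 3 := by positivity
  have hb23 : (0:ℚ) < (b + 2) / 3 := by positivity
  have h1 := triWRep2_sub_sub a b ha hb ha2 hb13 hb23
  rw [sub_sub] at h1
  have h2 := mkQ_eq_mkQ_iff.mpr h1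
  rwa [map_add, mkQ_constMul_ratCast, mkQ_constMul_ratCast, ← betaQ_eq ha2 hb13,
    ← betaQ_eq ha2 hb23] at h2

/-- **Triplication, the shadow `3a+b=3` (`a > 1/2`, `b > 0`).**
`(2-2a)•β(a,b) = 3^{b-1} • [((3a-2)/3)•β(2a-1,(b+1)/3) + ((3a-1)/3)•β(2a-1,(b+2)/3)]` in `Q` — one
substitution, ONE Newton–Leibniz move, two additivity splits, no division. -/
theorem betaQ_tripl2_second (a b : ℚ) (ha : 1 / 2 < a) (hb : 0 < b) (h : 3 * a + b = 3) :
    ((2 - 2 * a : ℚ) : K₀) • betaQ a b = triCoeff b •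
      ((((3 * a - 2) / 3 : ℚ) : K₀) • betaQ (2 * a - 1) ((b + 1) / 3) +
        (((3 * a - 1) / 3 : ℚ) : K₀) • betaQ (2 * a - 1) ((b + 2) / 3)) := by
  rw [betaQ_eq_triCoeff_smul_P2 a b ha hb h, ← mkQ_triWRep2 a b ha hb,
    eq_neg_of_add_eq_zero_right (triP2_add_triW2_eq_zero a b ha hb h), smul_neg]
  simp only [smul_smul, ← neg_smul]
  congr 1
  push_cast
  ring

/-- **Level 9**: `(4/9)•β(7/9, 2/3) = 3^{-1/3} • [(1/9)•β(5/9, 5/9) + (4/9)•β(5/9, 8/9)]`,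
the merge `{5,6,7} ~ {5,5,8}` at `N = 9`. -/
theorem betaQ_tripl_nine_567 :
    ((4 / 9 : ℚ) : K₀) • betaQ (7 / 9) (2 / 3) = triCoeff (2 / 3) •
      (((1 / 9 : ℚ) : K₀) • betaQ (5 / 9) (5 / 9) + ((4 / 9 : ℚ) : K₀) • betaQ (5 / 9) (8 / 9)) := by
  have h := betaQ_tripl2_second (7 / 9) (2 / 3) (by norm_num) (by norm_num) (by norm_num)
  rw [show (2 : ℚ) - 2 * (7 / 9) = 4 / 9 by norm_num, show (2 : ℚ) * (7 / 9) - 1 = 5 / 9 by norm_num,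
    show ((2 / 3 : ℚ) + 1) / 3 = 5 / 9 by norm_num, show ((2 / 3 : ℚ) + 2) / 3 = 8 / 9 by norm_num,
    show ((3 : ℚ) * (7 / 9) - 2) / 3 = 1 / 9 by norm_num,
    show ((3 : ℚ) * (7 / 9) - 1) / 3 = 4 / 9 by norm_num] at h
  exact h

/-- **Level 9**: `(2/9)•β(8/9, 1/3) = 3^{-2/3} • [(2/9)•β(7/9, 4/9) + (5/9)•β(7/9, 7/9)]`,
the merge `{3,7,8} ~ {4,7,7}` at `N = 9`. -/
theorem betaQ_tripl_nine_378 :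
    ((2 / 9 : ℚ) : K₀) • betaQ (8 / 9) (1 / 3) = triCoeff (1 / 3) •
      (((2 / 9 : ℚ) : K₀) • betaQ (7 / 9) (4 / 9) + ((5 / 9 : ℚ) : K₀) • betaQ (7 / 9) (7 / 9)) := by
  have h := betaQ_tripl2_second (8 / 9) (1 / 3) (by norm_num) (by norm_num) (by norm_num)
  rw [show (2 : ℚ) - 2 * (8 / 9) = 2 / 9 by norm_num, show (2 : ℚ) * (8 / 9) - 1 = 7 / 9 by norm_num,
    show ((1 / 3 : ℚ) + 1) / 3 = 4 / 9 by norm_num, show ((1 / 3 : ℚ) + 2) / 3 = 7 / 9 by norm_num,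
    show ((3 : ℚ) * (8 / 9) - 2) / 3 = 2 / 9 by norm_num,
    show ((3 : ℚ) * (8 / 9) - 1) / 3 = 5 / 9 by norm_num] at h
  exact h

end SoloBlind

end

end Summit.KontsevichZagierPeriods.KontsevichZagierPeriods.Theorems
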